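import Summits.HubbardSuperconductivity.HubbardSuperconductivity.Theorems.AnisotropyChordTowerLowestWeight
import Summits.HubbardSuperconductivity.HubbardSuperconductivity.Theorems.AnisotropyChordTowerSectorPerron
import Summits.HubbardSuperconductivity.HubbardSuperconductivity.Theorems.AnisotropyChordTowerDeficit

/-!
# Route `AnisotropyChord` / H0 rotor rung: THE FIRST-ORDER CORRECTION `φ₁` of a sector ground state near the
# ferromagnetic point — one-magnon closure, first-order equation, orthogonality, norm, and the complete-graph eigen-relation
# (work-order v13(c) of theory seat `hubbard-h0-rotor-theory-1`, memo ROTOR-THEORY-11 §160 (γ1), §161 (c); director CYCLE-12 (A))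

With `v : Sec V 2 → ℝ` the solved two-magnon vector (`Σ v = 0`, `A_2 v = u`, `S⁻(ext v) = 0`, `…TowerLowestWeight`) and
`rV n v := res_n ((S⁺)^{n−2} ext v)`, `rU := res_n ((S⁺)^{n−2} u)`:
* `raiseIter_smul'`, `fmOp_raiseIter` (`[A, (S⁺)^k] = 0`), `raiseIter_secExt_support`;
* **`secOp_rV`** : `A_n (rV) = rU` (first-order equation, up to the common scalar);
* **`secW_const`** : ONE-MAGNON CLOSURE `W_n 1 = w₀·1 + rU/(n−2)!`, `w₀ = D/8 − d n/2 + κ C(n,2)` (`isingW_eq`, `degree_count`,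
  `raiseIter_edgeMinusMean`);
* **`sum_rV_eq_zero`** : `Σ_{Sec n} rV = 0` (`φ₁ ⟂ φ₀`; `inner_raiseIter` against the raised two-particle indicator);
* **`rV_normSq`** : `‖rV‖² = ∏_{i<n−2} (i+1)(|V|−4−i) · ‖v‖²` (`normSq_raiseIter`);
* **`secOp_top_rV`** : `B_n rV = (|V| − 1)·rV` (LEMMA J2 `fmOp_top_lowestWeight_two` raised).
-/

set_option linter.dupNamespace false
set_option autoImplicit false

noncomputable section

open Finset Matrix
open Summit.HubbardSuperconductivity.HubbardSuperconductivity.Theorems.AnisotropyChord.InsertionEntropy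

namespace Summit.HubbardSuperconductivity.HubbardSuperconductivity.Theorems.AnisotropyChord.Tower

variable {V : Type} [Fintype V] [DecidableEq V]

/-! ### The raising tower: homogeneity, commutation with `A`, support -/

section Raise

/-- `(S⁺)^k` is homogeneous. [folklore] -/
theorem raiseIter_smul' (k : ℕ) (c : ℝ) (b : (V → Fin 2) → ℝ) :
    raiseIter k (fun σ => c * b σ) = fun σ => c * raiseIter k b σ := by
  induction k with
  | zero => rfl
  | succ k ih =>
    show raiseSum (raiseIter k (fun σ => c * b σ)) = fun σ => c * raiseSum (raiseIter k b) σ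
    rw [ih, raiseSum_smul]

variable (G : SimpleGraph V) [DecidableRel G.Adj]

/-- **`[A, (S⁺)^k] = 0`.** [folklore] -/
theorem fmOp_raiseIter (k : ℕ) (b : (V → Fin 2) → ℝ) : fmOp G (raiseIter k b) = raiseIter k (fmOp G b) := by
  induction k with
  | zero => rfl
  | succ k ih =>
    show fmOp G (raiseSum (raiseIter k b)) = raiseSum (raiseIter k (fmOp G b))
    rw [← raiseSum_fmOp, ih]

/-- `(S⁺)^k (ext_2 v)` lives on the sector `2 + k`. [folklore] -/
theorem raiseIter_secExt_support (v : Sec V 2 → ℝ) (k : ℕ) :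
    ∀ σ, raiseIter k (secExt 2 v) σ ≠ 0 → zerosCard σ = ((k + 2 : ℕ) : ℝ) := by
  intro σ hσ
  have h := raiseIter_support (secExt 2 v) 2 (fun ν hν => by rw [secExt_support v ν hν]; norm_num) k σ hσ
  rw [h]; push_cast; ring

end Raise

/-! ### `rV`, `rU` and the first-order identities on the sector `n = k + 2` -/

section FirstOrder

variable (G : SimpleGraph V) [DecidableRel G.Adj]

/-- The raised solved vector on the sector `k + 2`: `rV = res ((S⁺)^k ext v)`. [folklore] -/
def rV (k : ℕ) (v : Sec V 2 → ℝ) : Sec V (k + 2) → ℝ := secRes (k + 2) (raiseIter k (secExt 2 v))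

/-- The raised right-hand side on the sector `k + 2`: `rU = res ((S⁺)^k u)`, `u = edgeMinusMean G κ`. [folklore] -/
def rU (k : ℕ) (κ : ℝ) : Sec V (k + 2) → ℝ := secRes (k + 2) (raiseIter k (edgeMinusMean G κ))

/-- `ext rV = (S⁺)^k ext v`. [folklore] -/
theorem secExt_rV (k : ℕ) (v : Sec V 2 → ℝ) : secExt (k + 2) (rV k v) = raiseIter k (secExt 2 v) :=
  secExt_secRes _ (raiseIter_secExt_support v k)

/-- **FIRST-ORDER EQUATION (raised):** `A_{k+2} rV = rU` when `A_2 v = u`. [folklore] -/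
theorem secOp_rV (k : ℕ) (κ : ℝ) (v : Sec V 2 → ℝ) (hAv : secOp G 2 v = secRes 2 (edgeMinusMean G κ)) :
    secOp G (k + 2) (rV k v) = rU G k κ := by
  funext s
  rw [secOp_apply, secExt_rV, fmOp_raiseIter]
  have hAb : fmOp G (secExt 2 v) = edgeMinusMean G κ := by
    rw [← secExt_secOp, hAv, secExt_secRes_edgeMinusMean]
  rw [hAb]
  rfl

/-- **ONE-MAGNON CLOSURE on the sector:** on a graph with constant vertex degree `d`, for `n = k + 2` and any constant `c`:
`W_n (c·1) = w₀·(c·1) + (c/k!)·rU`, `w₀ = D/8 − d n/2 + κ C(n,2)`. [folklore] -/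
theorem secW_const (d : ℕ) (κ : ℝ) (hreg : ∀ x : V, (∑ y, if G.Adj x y then (1:ℝ) else 0) = d) (k : ℕ) (c : ℝ) :
    secW G (k + 2) (fun _ => c)
      = ((1/8 : ℝ) * (∑ x, ∑ y, if G.Adj x y then (1:ℝ) else 0) - (d : ℝ) * (k + 2 : ℕ) / 2
          + κ * ((k + 2).choose 2 : ℕ)) • (fun _ : Sec V (k + 2) => c)
        + (c / (k.factorial : ℝ)) • rU G k κ := by
  funext s
  simp only [secW_apply, Pi.add_apply, Pi.smul_apply, smul_eq_mul]
  unfold rU secRes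
  have hs : zerosCard s.1 = ((k + 2 : ℕ) : ℝ) := zerosCard_sec s
  have h1 := isingW_eq G s.1
  have h2 := degree_count G d hreg s.1
  have h3 := raiseIter_edgeMinusMean G κ (k + 2) (by omega) s.1 hs
  simp only [Nat.add_sub_cancel] at h3
  have hk : (k.factorial : ℝ) ≠ 0 := by exact_mod_cast (Nat.factorial_pos k).ne'
  rw [hs] at h2
  push_cast at h2
  have h2' : brokenOrd G s.1 = (d : ℝ) * ((k : ℝ) + 2) - insideOrd G s.1 := by linarith
  rw [h1, h3, h2', show c / (k.factorial : ℝ) * ((k.factorial : ℝ) * ((1/2 : ℝ) * insideOrd G s.1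
      - κ * (((k + 2).choose 2 : ℕ) : ℝ))) = c * ((1/2 : ℝ) * insideOrd G s.1 - κ * (((k + 2).choose 2 : ℕ) : ℝ)) by
    field_simp]
  push_cast
  ring

/-- The raised two-particle indicator is the constant `k!·C(k+2, 2)` on the sector `k + 2`. [folklore] -/
theorem raiseIter_indTwo (k : ℕ) (σ : V → Fin 2) (hσ : zerosCard σ = ((k + 2 : ℕ) : ℝ)) :
    raiseIter k (secExt 2 (fun _ : Sec V 2 => (1:ℝ))) σ = (k.factorial : ℝ) * ((k + 2).choose 2 : ℕ) := by
  have hsupp : ∀ ν, secExt 2 (fun _ : Sec V 2 => (1:ℝ)) ν ≠ 0 → zerosCard ν = (2 : ℕ) :=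
    fun ν hν => secExt_support _ ν hν
  rw [raiseIter_eq_subsetSum _ 2 hsupp k σ (by rw [hσ]; push_cast; ring)]
  congr 1
  have hT : ∀ T ∈ (zeroSet σ).powersetCard 2, secExt 2 (fun _ : Sec V 2 => (1:ℝ)) (cfgOf T) = 1 := by
    intro T hT
    have hc : (zeroSet (cfgOf T)).card = 2 := by rw [zeroSet_cfgOf]; exact (Finset.mem_powersetCard.1 hT).2
    exact secExt_apply_sec (fun _ : Sec V 2 => (1:ℝ)) ⟨cfgOf T, hc⟩
  rw [Finset.sum_congr rfl hT, Finset.sum_const, Finset.card_powersetCard, nsmul_eq_mul, mul_one]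
  have hcard : (zeroSet σ).card = k + 2 := by
    have := hσ; rw [zerosCard_eq_card] at this; exact_mod_cast this
  rw [hcard]

/-- **`φ₁ ⟂ φ₀`**: `Σ_{Sec (k+2)} rV = 0` when `Σ v = 0` and `S⁻(ext v) = 0`. [folklore] -/
theorem sum_rV_eq_zero (k : ℕ) (v : Sec V 2 → ℝ) (hv : ∑ s, v s = 0)
    (hlow : lowerSum (secExt 2 v) = fun _ => 0) : ∑ s, rV k v s = 0 := by
  -- `Σ_sector rV = Σ_σ (S⁺)^k ext v`
  have hfull : ∑ s : Sec V (k + 2), rV k v s = ∑ σ, raiseIter k (secExt 2 v) σ := by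
    have h := sum_secExt_mul (fun _ : Sec V (k + 2) => (1:ℝ)) (raiseIter k (secExt 2 v))
    simp only [one_mul] at h
    rw [show (∑ s : Sec V (k + 2), rV k v s) = ∑ s : Sec V (k + 2), raiseIter k (secExt 2 v) s.1 from rfl, ← h]
    refine Finset.sum_congr rfl fun σ _ => ?_
    by_cases hσ : (zeroSet σ).card = k + 2
    · rw [show secExt (k + 2) (fun _ : Sec V (k + 2) => (1:ℝ)) σ = 1 from secExt_apply_sec _ ⟨σ, hσ⟩, one_mul]
    · rw [secExt_of_ne _ hσ, zero_mul]
      by_contra hne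
      exact hσ ((card_zeroSet_eq_iff σ).2 (raiseIter_secExt_support v k σ (Ne.symm hne)))
  -- pair against the raised indicator
  have hsupp2 : ∀ ν, secExt 2 v ν ≠ 0 → zerosCard ν = (2 : ℝ) := fun ν hν => by
    rw [secExt_support v ν hν]; norm_num
  have hinner := inner_raiseIter (secExt 2 (fun _ : Sec V 2 => (1:ℝ))) (secExt 2 v) 2 hsupp2 hlow k
  have hzero : ∑ σ, secExt 2 (fun _ : Sec V 2 => (1:ℝ)) σ * secExt 2 v σ = 0 := by
    rw [sum_secExt_mul]; simp only [one_mul, secExt_apply_sec]; exact hv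
  rw [hzero, mul_zero] at hinner
  -- on the support of the tower the indicator tower is the nonzero constant `k! C(k+2,2)`
  have hconst : ∑ σ, raiseIter k (secExt 2 (fun _ : Sec V 2 => (1:ℝ))) σ * raiseIter k (secExt 2 v) σ
      = ((k.factorial : ℝ) * ((k + 2).choose 2 : ℕ)) * ∑ σ, raiseIter k (secExt 2 v) σ := by
    rw [Finset.mul_sum]
    refine Finset.sum_congr rfl fun σ _ => ?_
    by_cases hσ : raiseIter k (secExt 2 v) σ = 0
    · rw [hσ, mul_zero, mul_zero]
    · rw [raiseIter_indTwo k σ (raiseIter_secExt_support v k σ hσ)]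
  rw [hconst] at hinner
  have hne : ((k.factorial : ℝ) * ((k + 2).choose 2 : ℕ)) ≠ 0 := by
    have h1 : (0:ℝ) < k.factorial := by exact_mod_cast Nat.factorial_pos k
    have h2 : (0:ℝ) < ((k + 2).choose 2 : ℕ) := by exact_mod_cast Nat.choose_pos (by omega)
    positivity
  rw [hfull]
  rcases mul_eq_zero.1 hinner with h | h
  · exact absurd h hne
  · exact h

/-- **NORM OF THE RAISED VECTOR:** `‖rV‖² = ∏_{i<k} (i+1)(|V| − 4 − i) · ‖v‖²` (`S⁻(ext v) = 0`). [folklore] -/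
theorem rV_normSq (k : ℕ) (v : Sec V 2 → ℝ) (hlow : lowerSum (secExt 2 v) = fun _ => 0) :
    rV k v ⬝ᵥ rV k v = (∏ i ∈ Finset.range k, ladderCoeff (V := V) 2 i) * (v ⬝ᵥ v) := by
  have hsupp2 : ∀ ν, secExt 2 v ν ≠ 0 → zerosCard ν = (2 : ℝ) := fun ν hν => by
    rw [secExt_support v ν hν]; norm_num
  rw [← sum_secExt_sq, secExt_rV, normSq_raiseIter (secExt 2 v) 2 hsupp2 hlow k, sum_secExt_sq]

/-- **`B_n rV = (|V| − 1)·rV`**: the complete-graph form acts on the raised lowest-weight two-magnon vector as the scalar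
`|V| − 1 = 2S − 1` (LEMMA J2 raised by `[B, S⁺] = 0`). [folklore] -/
theorem secOp_top_rV (k : ℕ) (v : Sec V 2 → ℝ) (hlow : lowerSum (secExt 2 v) = fun _ => 0) :
    secOp (⊤ : SimpleGraph V) (k + 2) (rV k v) = ((Fintype.card V : ℝ) - 1) • rV k v := by
  have hsupp2 : ∀ ν, secExt 2 v ν ≠ 0 → zerosCard ν = 2 := fun ν hν => by
    rw [secExt_support v ν hν]; norm_num
  funext s
  rw [secOp_apply, secExt_rV, fmOp_raiseIter, fmOp_top_lowestWeight_two (secExt 2 v) hsupp2 hlow, raiseIter_smul',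
    Pi.smul_apply, smul_eq_mul]
  rfl

end FirstOrder

end Summit.HubbardSuperconductivity.HubbardSuperconductivity.Theorems.AnisotropyChord.Tower
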